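import Literature.Probability.LatticeModels.FKIsingInterfaceTightness
import Literature.Probability.RandomPlanarGeometry.SLEDrivingCoupling
import HarnessLib

/-!
# FK-Ising interfaces and SLE_{16/3}: the former layer 2 of the identification step (merged)

Topic `Literature/Probability/LatticeModels` (trunk `StatMech`, family `crit-ising`). This module
used to be the second layer, identification half, of the decomposition of the named fact
`Literature.Probability.LatticeModels.convergesInLawToSLE_sixteen_thirds_fkInterface`
(**crit-ising.S17**, FK half; Chelkak–Duminil-Copin–Hongler–Kemppainen–Smirnov, C. R. Math. 352
(2014), Thm. 2). Layer 1 (`FKIsingInterfaceSLE.lean`) isolates the identification fact **(L)**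
`isSLELaw_of_isSubseqLimitLaw_fkInterfaceCurve`: every subsequential limit law of the critical
FK-Ising interfaces is the chordal SLE_{16/3} law of `(D; a, b)` (Duminil-Copin–Smirnov, Clay
Math. Proc. 15 (2012), Thm. 6.4 and Prop. 6.7; CDHKS Thm. 3 and §3). Layer 2 vendored here, as a
further named fact **(L′)** `exists_isSLEDrivingCoupling_of_isSubseqLimitLaw_fkInterfaceCurve`,
the printed conclusion of DCS Thm. 6.4 + Prop. 6.7 *before* its closing sentence: every
subsequential limit law `μ` admits, through some chordal uniformizing map `φ` of `(D; a, b)`, a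
coupling `ν` with the pre-Wiener measure under which, almost surely, the curve is the
time-compactified `φ`-image of the curve generating the Loewner chain driven by `√(16/3) B`
(`IsSLEDrivingCoupling (16/3) D φ μ ν`, `RandomPlanarGeometry/SLEDrivingCoupling.lean`), and
proved (L′) ∧ (Rohde–Schramm at `κ ≠ 8`) ⟹ (L) (`isSLELaw_of_isSubseqLimitLaw_fkInterfaceCurve_of_coupling`)
and the assembly `convergesInLawToSLE_sixteen_thirds_fkInterface_of_layer2`.

**Review note (D-0026, 2026-08-15): the named fact (L′) is merged back into (L).** The
prove-seat of (L′) triaged it XL and parked twice on the layer-5 fact (M5′)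
`exists_cylinderObservableIdentity_fkInterface` (`FKIsingNaturalMartingale.lean`), a
prerequisite the harness could not resolve; decompositions do not recurse. The review of the
split, with Duminil-Copin–Smirnov 2012, §6 (arXiv pp. 27–29: Thm. 6.4, Thm. 6.5, Lemma 6.6,
Prop. 6.7 and its proof) and CDHKS 2014 (arXiv pp. 4–7: Thms 2, 3, 4 and §3) open, found:

* (L′) is faithful to the source (DCS Thm. 6.4: "Any sub-sequential limit of the family
  `(γ_δ)_{δ>0}` of FK-Ising interfaces is a time-changed Loewner chain"; proof of Prop. 6.7,
  p. 29: "Since `W_t` is continuous, Lévy's theorem implies that `W_t = √(16/3) B_t` where `B_t`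
  is a standard Brownian motion") and is neither mis-stated nor an open problem;
* but it is not a distinct, separately citable result: DCS pass from it to (L) by one
  definitional sentence — "In conclusion, `γ` is the image by `φ⁻¹` of the chordal
  Schramm–Loewner Evolution with parameter `κ = 16/3` in the upper half-plane. This is exactly
  the definition of the chordal Schramm–Loewner Evolution with parameter `κ = 16/3` in the
  domain `(Ω, a, b)`" (p. 29) — and in the tree that sentence is a theorem in both directions
  at `κ = 16/3` (`isSLELaw_sixteen_thirds_iff_exists_isSLEDrivingCoupling`,
  `FKIsingInterfaceIdentificationProofs.lean`: the `κ`-local transport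
  `isSLELaw_of_isSLEDrivingCoupling_of_ae_tendsto` fed with the PROVED Rohde–Schramm Cor. 3.5,
  and conversely the unfolding of `IsSLELaw`), so that **(L′) ⟺ (L) was itself a proved theorem
  of the tree** (`exists_isSLEDrivingCoupling_of_isSubseqLimitLaw_fkInterfaceCurve_iff_isSLELaw`
  of the previous `FKIsingInterfaceIdentificationProofs.lean`): two named facts for one claim;
* it is not provable inline either: (L′) carries exactly (L)'s unvendored inputs — (J)
  Kemppainen–Smirnov 2017, Thm. 1.5 with Cor. 1.7 (Loewner regularity of subsequential limits
  and convergence of the driving processes, from Condition G2 = CDHKS Thm. 4 / KS Prop. 4.3 for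
  FK-Ising; ≈ 80 pp.) and (D) DCS Lemma 6.6 with Smirnov, Ann. Math. 172 (2010), Thm. 2.2
  uniformly over the slit domains — which the tree has meanwhile isolated as the two THEOREM
  HYPOTHESES of `isSLELaw_of_isSubseqLimitLaw_fkInterfaceCurve_of_limitData`
  (`FKIsingCylinderIdentityAssembly.lean`), everything between them and (L) being proved.

(L′) was therefore MERGED back into (L)'s proof obligation, exactly as the spin-side fact (M)
`exists_drivingMartingales_of_subseqLimit_spinInterface` was merged into F2
(`InterfaceSLEIdentification.lean`, review note): the `def` and its two consumers
`isSLELaw_of_isSubseqLimitLaw_fkInterfaceCurve_of_coupling`,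
`convergesInLawToSLE_sixteen_thirds_fkInterface_of_layer2` are deleted here; the (L′)-valued
glue elsewhere was deleted or restated with the body of (L′) unfolded
(`FKIsingInterfaceIdentificationProofs.lean`, `FKIsingDrivingMartingale.lean`,
`InterfaceSLEIdentification.lean`). Nothing is lost:

* the CONTENT of (L′) survives as theorems — locally and unconditionally as
  `isSLELaw_sixteen_thirds_iff_exists_isSLEDrivingCoupling` (`IsSLELaw (16/3) D μ ↔ ∃ φ ν,
  IsSLEDrivingCoupling (16/3) D φ μ ν`), from the layer-3 fact (L″) as
  `exists_isSLEDrivingCoupling_through_of_exists_drivingMartingale` /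
  `exists_isSLEDrivingCoupling_of_isSubseqLimitLaw_fkInterfaceCurve_of_exists_drivingMartingale`,
  and globally as `isSLELaw_of_isSubseqLimitLaw_fkInterfaceCurve_of_exists_isSLEDrivingCoupling`
  (couplings for every limit ⟹ (L)), all in `FKIsingInterfaceIdentificationProofs.lean`;
* the ASSEMBLIES survive in their (L)-form: (C1) ∧ (L) ⟹ CDHKS Thm. 2
  (`convergesInLawToSLE_sixteen_thirds_fkInterface_of_traversalBound'`,
  `InterfaceSLEIdentification.lean`; `…_of_traversalBound`, `FKIsingInterfaceTightness.lean`),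
  (L″)/(L‴)/(M5′) ⟹ (L) (`isSLELaw_of_isSubseqLimitLaw_fkInterfaceCurve_of_exists_drivingMartingale`,
  `…_of_exists_observableMartingale`, `…_of_cylinderIdentity`, `FKIsingInterfaceSLEAssembly.lean`);
* the named-fact frontier below crit-ising.S17 (FK) is unchanged: the FK traversal bound (C1)
  `fkInterface_traversalBound` (`FKIsingInterfaceTightness.lean`) and, below (L), (M5′) alone.

What remains in this module: the two numeric facts about `16/3 ∈ ℝ≥0` used by the layers below
(`sixteen_thirds_ne_eight`, `sixteen_thirds_pos`), and the imports its dependents rely on.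

## References

* H. Duminil-Copin, S. Smirnov, *Conformal invariance of lattice models*, Clay Math. Proc. 15
  (2012) 213–276 (arXiv:1109.1549): Thm. 6.4, Thm. 6.5, Lemma 6.6, Prop. 6.7 and its proof,
  proof of Thm. 3.13 (pp. 28–29 of the arXiv version).
* D. Chelkak, H. Duminil-Copin, C. Hongler, A. Kemppainen, S. Smirnov, *Convergence of Ising
  interfaces to Schramm's SLE curves*, C. R. Math. Acad. Sci. Paris 352 (2014) 157–161, Thm. 2,
  Thm. 3, Thm. 4, §3.
* A. Kemppainen, S. Smirnov, *Random curves, scaling limits and Loewner evolutions*, Ann. Probab.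
  45 (2017) 698–779, Thm. 1.5 and Cor. 1.7 (arXiv numbering: Thm. 1.3, Cor. 1.5), Prop. 4.3.
* S. Smirnov, *Conformal invariance in random cluster models. I*, Ann. Math. 172 (2010), Thm. 2.2.
* S. Rohde, O. Schramm, *Basic properties of SLE*, Ann. Math. 161 (2005), Cor. 3.5, Thms 5.1, 7.1.
-/

noncomputable section

open scoped NNReal

namespace Literature.Probability.LatticeModels

/-- `16/3 ≠ 8` in `ℝ≥0` (the FK-Ising SLE parameter is in the Rohde–Schramm range). [folklore] -/
theorem sixteen_thirds_ne_eight : (16 / 3 : ℝ≥0) ≠ 8 := by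
  intro h
  have h' : ((16 / 3 : ℝ≥0) : ℝ) = ((8 : ℝ≥0) : ℝ) := by rw [h]
  norm_num at h'

/-- `0 < 16/3` in `ℝ≥0`. [folklore] -/
theorem sixteen_thirds_pos : (0 : ℝ≥0) < 16 / 3 := by
  have h' : (0 : ℝ) < ((16 / 3 : ℝ≥0) : ℝ) := by norm_num
  exact_mod_cast h'

end Literature.Probability.LatticeModels
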